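/-
Copyright (c) 2026 the pub-hodgecm-mathlib formalisation cell (harness21).  Prover seat hodgecm-mathlib-K2E4-p14 (g5), Track B ∕ K2-LIT, h413 =
`stmt-HodgeConjecture-24833`, line `K2_E1_TraceFormulaBeta`, campaign «EIS-RANK-ONE» rung R6f(ii) at `N = 2`; DEAL «MS-TWO» of the dealer K2E1-plan (g3) 2026-09-04T05:48:57Z,
file (2): the `U(J₂)` twin of ★ p857669∕p857683 `K2E1MaassSelbergCMThree` and ★ p857703 `K2E1MaassSelbergCMThreeAdjoint` (cuts (C2)∕ED. 3 of «EIS-R6-CM»).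
-/
import Summits.HodgeConjecture.HodgeConjecture.Theorems.K2E1MaassSelbergBracketsTwo       -- ★ file (1) (this seat): the four flat-section brackets of `U(J₂)` over ★ (δ)_two
import Summits.HodgeConjecture.HodgeConjecture.Theorems.K2E1BorelEisensteinGodementCMTwo  -- ★ p857569 (K2E1-p08 g4): R2 CM `summable_eisensteinSeriesU_flatSectionU_cm_two` (`Re z > 1`)
import Summits.HodgeConjecture.HodgeConjecture.Theorems.K2E1BorelWeightAverage          -- ★ p857644 (K2E4-p11 g3): «AVG» `…_two`; imports ★ p857605 `K2E1IntertwiningAdjoint` (`…_two`)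
import HarnessLib

/-!
# K2·E1 — `K2E1MaassSelbergCMTwo`: THE MAASS–SELBERG RELATION FOR FLAT SECTIONS OF `U(J₂)` — GENERIC QUADRATIC `(F,E,c)`, THE CM PAIR, CONCRETE INTERTWINING OPERATORS
# (campaign «EIS-RANK-ONE», rung R6f(ii), deal «MS-TWO» file (2): ★ `maassSelberg_inner_truncation_two` with `hδ₁…hδ₄`, `hi₁…hi₄`, `hs₁`, `hs₂`, `hAVG`, `hadj` (and `hsum` at CM) discharged)

Track B ∕ K2-LIT, crux h413 = `stmt-HodgeConjecture-24833`, route of record `HCCMUnconditional`; cell `hodgecm-mathlib`, squad K2, ENGINE E1.  Prover seat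
`hodgecm-mathlib-K2E4-p14` (g5); DEAL «MS-TWO» of the dealer K2E1-plan (g3) 2026-09-04T05:48:57Z (REPORT-FIRST).  THEOREMS ONLY (no `def`, no `instance`, no notation, no named-fact
hypothesis, no `sorry`); lane `--supports stmt-HodgeConjecture-24833 --as helper` (count-neutral).  Closes no socket.

THE MATHEMATICS [MoeglinWaldspurger1995, IV.2.1–IV.2.3; Arthur1980TraceFormulaII, §4; Garrett2018, §11.3].  `G = U(J₂)` has `F`-rank one and `2ρ_H = 1`: the flat sections are
`f = flatSectionU φ z`, `f′ = flatSectionU φ′ z′` (★ R1 p857359), their intertwined sections `Mf = flatSectionU φ̃ (1 − z)`, `Mf′ = flatSectionU φ̃′ (1 − z′)` (exponent `2ρ − z`; the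
coefficients `φ̃, φ̃′` enter ABSTRACTLY, their relation to the intertwining integral riding in `hCT`∕`hCT′`∕`hM′ψ`), on the sub-tube `1 < Re z′ < Re z`.
§1 **`maassSelberg_flatSectionU_two`** (generic `c² = 1`, `c ≠ 1`, Iwasawa `hBK`): ★ `maassSelberg_inner_truncation_two` with **`s₁ := z + conj z′ − 1`, `s₂ := z − conj z′`** (`0 < Re sᵢ` from
the sub-tube), the four weight-level → idele-class inputs `hδ₁…hδ₄` and `hi₁…hi₄` DISCHARGED by ★ file (1) `exists_integral_weight_smul_cutoffs_flatSectionU_mul_conj_eq_two` at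
`(α,a,α′,a′) = (φ,z,φ′,z′), (φ,z,φ̃′,1−z′), (φ̃,1−z,φ′,z′), (φ̃,1−z,φ̃′,1−z′)` — `a + conj a′ = s₁+1, s₂+1, −s₂+1, −s₁+1` is the checked bookkeeping — giving
**`⟨Λ^T E f, Λ′⟩_X = c_μ·K·((T^{s₁}∕s₁)[Ξ₁] + (T^{s₂}∕s₂)[Ξ₂] − (T^{−s₂}∕s₂)[Ξ₃] − (T^{−s₁}∕s₁)[Ξ₄])`**, `[Ξ] = ∫_{𝓕_I ∩ {‖x‖≤1}} ‖x‖·Ξ dν_I`, the `Ξᵢ` being the `K_U`-averages of the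
coefficient pairs along the torus pushed to `𝕀_E` (hypotheses `hΞᵢ`).  §2 **`summable_flatSectionU_cm_two`**: `hsum` at the CM pair `(L⁺, L, conj)` by ★ R2 CM p857569 (`Re z > 1`).
§3 **`maassSelberg_flatSectionU_two_adj`**: §1 with the averaging `hAVG` DISCHARGED by ★ p857644 `integral_wt_smul_mul_conj_eq_mul_conj_borelConstantTerm_two` (`CT′ := borelConstantTerm ν 𝓕 Λ′`)
and the intertwining operators CONCRETE — `M h (g) = ∫_{N(𝔸)} h(w₀ u g) dν`, `M′ h (g) = ∫_{N(𝔸)} h(w₀⁻¹ u g) dν`, `w₀ = toAdelic (weylLongU …)` — with `hadj` DISCHARGED by ★ p857605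
`integral_wt_smul_intertwining_mul_conj_eq_two` (conjugating both sides) under its absolute-convergence inputs `habs`, `habs′`.
NAMED INPUTS KEPT (supplier): `hCT` (★ R3 `borelConstantTerm_eisensteinSeriesU_two` under its Godement `hfin` + the flat-section intertwining identity), `hCT′`∕`hM′ψ` (★ R3 + ★ R6a∕R6c),
`habs`∕`habs′`, `hi₅`, `hψL1`, `Λ′` Borel `G(F)`-invariant bounded (★ R6e `_two` ∘ `hdec`), coefficient facts, `hΞᵢ`.
HONEST LABEL: HC_CM is proved only modulo the 7 printed citations (2 remaining named inputs: hLiu418 = `stmt-HodgeConjecture-24832`, h413 = `stmt-HodgeConjecture-24833`) until rung 0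
closes; this file asserts no named fact and closes no socket.
References: [MoeglinWaldspurger1995] II.1.8, IV.2.1–IV.2.3 · [Arthur1980TraceFormulaII] §4 · [Garrett2018] §1.10, §11.3 · [Rogawski1990] §2.2, §7.3 · [Godement1964] §8.
-/

set_option autoImplicit false
-- the mandated namespace repeats the single-problem summit's segment (`HodgeConjecture.HodgeConjecture`)
set_option linter.dupNamespace false

noncomputable section

open MeasureTheory Measure NumberField IsDedekindDomain Set MulAction
open scoped ENNReal NNReal ComplexConjugate
open Literature.MeasureTheory.Group Literature.NumberTheory
open Literature.NumberTheory.Automorphic Literature.NumberTheory.Automorphic.UnitaryGroup AdelicGroupData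
open Summit.HodgeConjecture.HodgeConjecture.Cruxes.H413.K2E1BorelEisensteinU
open Summit.HodgeConjecture.HodgeConjecture.Cruxes.H413.K2E1IdeleClassMellinWeighted
open Summit.HodgeConjecture.HodgeConjecture.Cruxes.H413.K2E1TorusHeightMellin
open Summit.HodgeConjecture.HodgeConjecture.Cruxes.H413.K2E1MaassSelbergFourBrackets
open Summit.HodgeConjecture.HodgeConjecture.Cruxes.H413.K2E1MaassSelbergU
open Summit.HodgeConjecture.HodgeConjecture.Cruxes.H413.K2E1MaassSelbergUTwo
open Summit.HodgeConjecture.HodgeConjecture.Cruxes.H413.K2E1MaassSelbergBracketsThree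
open Summit.HodgeConjecture.HodgeConjecture.Cruxes.H413.K2E1MaassSelbergBracketsTwo
open Summit.HodgeConjecture.HodgeConjecture.Cruxes.H413.K2E1BorelEisensteinGodementCMTwo

namespace Summit.HodgeConjecture.HodgeConjecture.Cruxes.H413.K2E1MaassSelbergCMTwo

/-! ## §1 Generic quadratic `(F, E, c)`: the relation for flat sections, `hδᵢ`∕`hiᵢ`∕`hsᵢ` discharged -/

section Generic

variable {F E : Type} [Field F] [NumberField F] [Field E] [NumberField E] [Algebra F E] {c : E ≃ₐ[F] E}
variable [MeasurableSpace (quasiSplit F E c 2).Adelic] [BorelSpace (quasiSplit F E c 2).Adelic]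
variable [MeasurableSpace (adelicUnipotent F E c 2)]
variable [MeasurableSpace (AdeleRing (𝓞 E) E)ˣ] [BorelSpace (AdeleRing (𝓞 E) E)ˣ]

/-- **THE MAASS–SELBERG RELATION FOR FLAT SECTIONS OF `U(J₂)`** (generic quadratic `E/F`, `c² = 1`, `c ≠ 1`; sub-tube `1 < Re z′ < Re z`): ★ `maassSelberg_inner_truncation_two`
at `f = φ·H^z`, `f′ = φ′·H^{z′}`, `Mf = φ̃·H^{1−z}`, `Mf′ = φ̃′·H^{1−z′}` (`2ρ_H = 1`) with `s₁ = z + conj z′ − 1`, `s₂ = z − conj z′`, the four weight-level → idele-class brackets and their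
integrabilities DISCHARGED by ★ file (1) `K2E1MaassSelbergBracketsTwo`; the remaining analytic inputs are named (module docstring). [cite: MoeglinWaldspurger1995, IV.2.1–IV.2.3] [cite: Arthur1980TraceFormulaII, §4]
[cite: Garrett2018, §11.3] -/
theorem maassSelberg_flatSectionU_two (hc : c * c = 1) (hc1 : c ≠ 1)
    (μ : Measure (quasiSplit F E c 2).automorphicQuotient) [(quasiSplit F E c 2).IsAutomorphicMeasure μ]
    (νG : Measure (quasiSplit F E c 2).Adelic) [νG.IsHaarMeasure] [νG.IsInvInvariant]
    (μK : Measure ((standardMaximalCompactGL 2 E).comap (adelicVal F E c 2 ((StdForm.antidiagonal 2).over E)) : Subgroup (quasiSplit F E c 2).Adelic))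
    [μK.IsHaarMeasure]
    (νI : Measure (AdeleRing (𝓞 E) E)ˣ) [νI.IsHaarMeasure]
    (hBK : ∀ g : (quasiSplit F E c 2).Adelic, ∃ b ∈ borelAdelic F E c 2, ∃ k : (quasiSplit F E c 2).Adelic,
      adelicVal F E c 2 ((StdForm.antidiagonal 2).over E) k ∈ standardMaximalCompactGL 2 E ∧ g = b * k)
    {𝓕I : Set (AdeleRing (𝓞 E) E)ˣ} (h𝓕I : IsIdeleClassDomain E 𝓕I) :
    ∃ cμ K : ℝ, 0 < cμ ∧ 0 < K ∧
      ∀ {β : (quasiSplit F E c 2).Adelic → ℝ≥0∞}, IsCoveringWeight ((arithmeticBorel F E c 2).map (quasiSplit F E c 2).arithmeticSubgroup.subtype) β →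
      ∀ {ν : Measure (adelicUnipotent F E c 2)} {𝓕 : Set (adelicUnipotent F E c 2)} {T : ℝ≥0}, 1 ≤ T →
      -- the four COEFFICIENTS `φ, φ′` (sections) and `φ̃, φ̃′` (intertwined sections): Borel, left-`N(𝔸)`∕`B(F)`-invariant, bounded
      ∀ {φ φ' φt φt' : (quasiSplit F E c 2).Adelic → ℂ},
      Measurable φ →
        (∀ (n : unipotentInBorel F E c 2) (y : (quasiSplit F E c 2).Adelic), φ (((n : borelAdelic F E c 2) : (quasiSplit F E c 2).Adelic) * y) = φ y) →
        (∀ b ∈ arithmeticBorel F E c 2, ∀ y : (quasiSplit F E c 2).Adelic, φ ((b : (quasiSplit F E c 2).Adelic) * y) = φ y) →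
      ∀ {Cφ : ℝ}, (∀ x, ‖φ x‖ ≤ Cφ) →
      Measurable φ' →
        (∀ (n : unipotentInBorel F E c 2) (y : (quasiSplit F E c 2).Adelic), φ' (((n : borelAdelic F E c 2) : (quasiSplit F E c 2).Adelic) * y) = φ' y) →
        (∀ b ∈ arithmeticBorel F E c 2, ∀ y : (quasiSplit F E c 2).Adelic, φ' ((b : (quasiSplit F E c 2).Adelic) * y) = φ' y) →
      ∀ {Cφ' : ℝ}, (∀ x, ‖φ' x‖ ≤ Cφ') →
      Measurable φt →
        (∀ (n : unipotentInBorel F E c 2) (y : (quasiSplit F E c 2).Adelic), φt (((n : borelAdelic F E c 2) : (quasiSplit F E c 2).Adelic) * y) = φt y) →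
        (∀ b ∈ arithmeticBorel F E c 2, ∀ y : (quasiSplit F E c 2).Adelic, φt ((b : (quasiSplit F E c 2).Adelic) * y) = φt y) →
      ∀ {Cφt : ℝ}, (∀ x, ‖φt x‖ ≤ Cφt) →
      Measurable φt' →
        (∀ (n : unipotentInBorel F E c 2) (y : (quasiSplit F E c 2).Adelic), φt' (((n : borelAdelic F E c 2) : (quasiSplit F E c 2).Adelic) * y) = φt' y) →
        (∀ b ∈ arithmeticBorel F E c 2, ∀ y : (quasiSplit F E c 2).Adelic, φt' ((b : (quasiSplit F E c 2).Adelic) * y) = φt' y) →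
      ∀ {Cφt' : ℝ}, (∀ x, ‖φt' x‖ ≤ Cφt') →
      -- the exponents on the sub-tube
      ∀ {z z' : ℂ}, 1 < z'.re → z'.re < z.re →
      -- NAMED INPUTS: constant term of `E(f_z)` (★ R3), summability (★ R2), the truncated second series `Λ′` (★ R6e), averaging∕two-piece CT∕adjoint∕R6a (★ AVG∕R3∕p857605∕R6a-c)
        (∀ x : (quasiSplit F E c 2).Adelic, T < borelHeight x → borelConstantTerm ν 𝓕 (eisensteinSeriesU (flatSectionU φ z)) x = flatSectionU φ z x + flatSectionU φt (1 - z) x) →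
        (∀ g : (quasiSplit F E c 2).Adelic,
          Summable fun q : Quotient (orbitRel ↥(borelU (c : E →+* E) ((StdForm.antidiagonal 2).over E)) ↥(unitaryGroupOfForm (c : E →+* E) ((StdForm.antidiagonal 2).over E))) =>
            flatSectionU φ z ((quasiSplit F E c 2).toAdelic (q.out : ↥(unitaryGroupOfForm (c : E →+* E) ((StdForm.antidiagonal 2).over E))) * g)) →
      ∀ {Λ' CT' : (quasiSplit F E c 2).Adelic → ℂ} {M M' : ((quasiSplit F E c 2).Adelic → ℂ) → ((quasiSplit F E c 2).Adelic → ℂ)},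
        Measurable Λ' → (∀ (γ : (quasiSplit F E c 2).arithmeticSubgroup) (x : (quasiSplit F E c 2).Adelic), Λ' ((γ : (quasiSplit F E c 2).Adelic) * x) = Λ' x) →
        ∀ {M₁ : ℝ}, (∀ g, ‖Λ' g‖ ≤ M₁) →
        ∫⁻ g, β g * ‖({y : (quasiSplit F E c 2).Adelic | borelHeight y ≤ T}.indicator (flatSectionU φ z) g - {y : (quasiSplit F E c 2).Adelic | T < borelHeight y}.indicator (flatSectionU φt (1 - z)) g)‖ₑ ∂νG < ∞ →
        ∫ g, (β g).toReal • (({y : (quasiSplit F E c 2).Adelic | borelHeight y ≤ T}.indicator (flatSectionU φ z) g - {y : (quasiSplit F E c 2).Adelic | T < borelHeight y}.indicator (flatSectionU φt (1 - z)) g) * conj (Λ' g)) ∂νG = ∫ g, (β g).toReal • (({y : (quasiSplit F E c 2).Adelic | borelHeight y ≤ T}.indicator (flatSectionU φ z) g - {y : (quasiSplit F E c 2).Adelic | T < borelHeight y}.indicator (flatSectionU φt (1 - z)) g) * conj (CT' g)) ∂νG →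
        (∀ g, CT' g = {y : (quasiSplit F E c 2).Adelic | borelHeight y ≤ T}.indicator (flatSectionU φ' z' + flatSectionU φt' (1 - z')) g - M ({y : (quasiSplit F E c 2).Adelic | T < borelHeight y}.indicator (flatSectionU φ' z' + flatSectionU φt' (1 - z'))) g) →
        ∫ g, (β g).toReal • (({y : (quasiSplit F E c 2).Adelic | borelHeight y ≤ T}.indicator (flatSectionU φ z) g - {y : (quasiSplit F E c 2).Adelic | T < borelHeight y}.indicator (flatSectionU φt (1 - z)) g) * conj (M ({y : (quasiSplit F E c 2).Adelic | T < borelHeight y}.indicator (flatSectionU φ' z' + flatSectionU φt' (1 - z'))) g)) ∂νG = ∫ g, (β g).toReal • (M' (fun x => {y : (quasiSplit F E c 2).Adelic | borelHeight y ≤ T}.indicator (flatSectionU φ z) x - {y : (quasiSplit F E c 2).Adelic | T < borelHeight y}.indicator (flatSectionU φt (1 - z)) x) g * conj (({y : (quasiSplit F E c 2).Adelic | T < borelHeight y}.indicator (flatSectionU φ' z' + flatSectionU φt' (1 - z'))) g)) ∂νG →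
        (∀ g, T < borelHeight g → M' (fun x => {y : (quasiSplit F E c 2).Adelic | borelHeight y ≤ T}.indicator (flatSectionU φ z) x - {y : (quasiSplit F E c 2).Adelic | T < borelHeight y}.indicator (flatSectionU φt (1 - z)) x) g = flatSectionU φt (1 - z) g) →
        Integrable (fun g => (β g).toReal • (({y : (quasiSplit F E c 2).Adelic | borelHeight y ≤ T}.indicator (flatSectionU φ z) g - {y : (quasiSplit F E c 2).Adelic | T < borelHeight y}.indicator (flatSectionU φt (1 - z)) g) * conj (M ({y : (quasiSplit F E c 2).Adelic | T < borelHeight y}.indicator (flatSectionU φ' z' + flatSectionU φt' (1 - z'))) g))) νG →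
      -- the four idele-class weights `Ξ₁…Ξ₄` = torus∕`K_U`-averages of the coefficient pairs (★ p857588 dichotomy decides them per character)
      ∀ {Ξ₁ Ξ₂ Ξ₃ Ξ₄ : (AdeleRing (𝓞 E) E)ˣ → ℂ},
      Measurable Ξ₁ → ∀ {CΞ₁ : ℝ}, (∀ x, ‖Ξ₁ x‖ ≤ CΞ₁) → (∀ k ∈ GaloisRepresentations.principalIdeles E, ∀ x, Ξ₁ (k * x) = Ξ₁ x) →
        (∀ (r : ℝ≥0ˣ) (x : (AdeleRing (𝓞 E) E)ˣ), Ξ₁ (posRealIdele E r * x) = Ξ₁ x) →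
        (∀ t : torusInBorel F E c 2,
          ∫ k, φ (((t : borelAdelic F E c 2) : (quasiSplit F E c 2).Adelic) * (k : (quasiSplit F E c 2).Adelic)) *
              conj (φ' (((t : borelAdelic F E c 2) : (quasiSplit F E c 2).Adelic) * (k : (quasiSplit F E c 2).Adelic))) ∂μK = Ξ₁ (diagUnit (t : borelAdelic F E c 2).2 0)) →
      Measurable Ξ₂ → ∀ {CΞ₂ : ℝ}, (∀ x, ‖Ξ₂ x‖ ≤ CΞ₂) → (∀ k ∈ GaloisRepresentations.principalIdeles E, ∀ x, Ξ₂ (k * x) = Ξ₂ x) →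
        (∀ (r : ℝ≥0ˣ) (x : (AdeleRing (𝓞 E) E)ˣ), Ξ₂ (posRealIdele E r * x) = Ξ₂ x) →
        (∀ t : torusInBorel F E c 2,
          ∫ k, φ (((t : borelAdelic F E c 2) : (quasiSplit F E c 2).Adelic) * (k : (quasiSplit F E c 2).Adelic)) *
              conj (φt' (((t : borelAdelic F E c 2) : (quasiSplit F E c 2).Adelic) * (k : (quasiSplit F E c 2).Adelic))) ∂μK = Ξ₂ (diagUnit (t : borelAdelic F E c 2).2 0)) →
      Measurable Ξ₃ → ∀ {CΞ₃ : ℝ}, (∀ x, ‖Ξ₃ x‖ ≤ CΞ₃) → (∀ k ∈ GaloisRepresentations.principalIdeles E, ∀ x, Ξ₃ (k * x) = Ξ₃ x) →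
        (∀ (r : ℝ≥0ˣ) (x : (AdeleRing (𝓞 E) E)ˣ), Ξ₃ (posRealIdele E r * x) = Ξ₃ x) →
        (∀ t : torusInBorel F E c 2,
          ∫ k, φt (((t : borelAdelic F E c 2) : (quasiSplit F E c 2).Adelic) * (k : (quasiSplit F E c 2).Adelic)) *
              conj (φ' (((t : borelAdelic F E c 2) : (quasiSplit F E c 2).Adelic) * (k : (quasiSplit F E c 2).Adelic))) ∂μK = Ξ₃ (diagUnit (t : borelAdelic F E c 2).2 0)) →
      Measurable Ξ₄ → ∀ {CΞ₄ : ℝ}, (∀ x, ‖Ξ₄ x‖ ≤ CΞ₄) → (∀ k ∈ GaloisRepresentations.principalIdeles E, ∀ x, Ξ₄ (k * x) = Ξ₄ x) →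
        (∀ (r : ℝ≥0ˣ) (x : (AdeleRing (𝓞 E) E)ˣ), Ξ₄ (posRealIdele E r * x) = Ξ₄ x) →
        (∀ t : torusInBorel F E c 2,
          ∫ k, φt (((t : borelAdelic F E c 2) : (quasiSplit F E c 2).Adelic) * (k : (quasiSplit F E c 2).Adelic)) *
              conj (φt' (((t : borelAdelic F E c 2) : (quasiSplit F E c 2).Adelic) * (k : (quasiSplit F E c 2).Adelic))) ∂μK = Ξ₄ (diagUnit (t : borelAdelic F E c 2).2 0)) →
      -- THE MAASS–SELBERG RELATION for flat sections of `U(J₂)`, `s₁ = z + conj z′ − 1`, `s₂ = z − conj z′`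
        ∫ x, (quasiSplit F E c 2).quotFun (truncation ν 𝓕 T (eisensteinSeriesU (flatSectionU φ z))) x * conj ((quasiSplit F E c 2).quotFun Λ' x) ∂μ =
          (cμ : ℂ) * ((K : ℂ) *
            ((((T : ℝ) : ℂ) ^ (z + conj z' - 1) / (z + conj z' - 1)) * (∫ x in {x : (AdeleRing (𝓞 E) E)ˣ | (IdeleClassGroup.ideleNorm E x : ℝ) ≤ 1} ∩ 𝓕I, ((IdeleClassGroup.ideleNorm E x : ℝ) : ℂ) * Ξ₁ x ∂νI)
              + (((T : ℝ) : ℂ) ^ (z - conj z') / (z - conj z')) * (∫ x in {x : (AdeleRing (𝓞 E) E)ˣ | (IdeleClassGroup.ideleNorm E x : ℝ) ≤ 1} ∩ 𝓕I, ((IdeleClassGroup.ideleNorm E x : ℝ) : ℂ) * Ξ₂ x ∂νI)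
              - (((T : ℝ) : ℂ) ^ (-(z - conj z')) / (z - conj z')) * (∫ x in {x : (AdeleRing (𝓞 E) E)ˣ | (IdeleClassGroup.ideleNorm E x : ℝ) ≤ 1} ∩ 𝓕I, ((IdeleClassGroup.ideleNorm E x : ℝ) : ℂ) * Ξ₃ x ∂νI)
              - (((T : ℝ) : ℂ) ^ (-(z + conj z' - 1)) / (z + conj z' - 1)) * (∫ x in {x : (AdeleRing (𝓞 E) E)ˣ | (IdeleClassGroup.ideleNorm E x : ℝ) ≤ 1} ∩ 𝓕I, ((IdeleClassGroup.ideleNorm E x : ℝ) : ℂ) * Ξ₄ x ∂νI))) := by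
  obtain ⟨cμ, hcμ, hMS⟩ := maassSelberg_inner_truncation_two μ νG νI h𝓕I
  obtain ⟨K, hK, hBr⟩ := exists_integral_weight_smul_cutoffs_flatSectionU_mul_conj_eq_two hc hc1 νG μK νI hBK h𝓕I
  refine ⟨cμ, K, hcμ, hK, ?_⟩
  intro β hβ ν 𝓕 T hT φ φ' φt φt' hφm hφN hφB Cφ hφC hφ'm hφ'N hφ'B Cφ' hφ'C hφtm hφtN hφtB Cφt hφtC hφt'm hφt'N hφt'B Cφt' hφt'C
    z z' hz' hzz' hCT hsum Λ' CT' M M' hΛm hΛG M₁ hΛbdd hψL1 hAVG hCT' hadj hM'ψ hi₅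
    Ξ₁ Ξ₂ Ξ₃ Ξ₄ hΞ₁m CΞ₁ hΞ₁C hΞ₁K hΞ₁M hΞ₁ hΞ₂m CΞ₂ hΞ₂C hΞ₂K hΞ₂M hΞ₂ hΞ₃m CΞ₃ hΞ₃C hΞ₃K hΞ₃M hΞ₃ hΞ₄m CΞ₄ hΞ₄C hΞ₄K hΞ₄M hΞ₄
  have hT0 : (0 : ℝ≥0) < T := lt_of_lt_of_le one_pos hT
  -- exponent bookkeeping on the sub-tube
  have hs₁ : 0 < (z + conj z' - 1).re := by simp only [Complex.sub_re, Complex.add_re, Complex.conj_re, Complex.one_re]; linarith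
  have hs₂ : 0 < (z - conj z').re := by simp only [Complex.sub_re, Complex.conj_re]; linarith
  have e₁ : 1 < (z + conj z').re := by simp only [Complex.add_re, Complex.conj_re]; linarith
  have e₂ : 1 < (z + conj (1 - z')).re := by simp only [Complex.add_re, Complex.conj_re, Complex.sub_re, Complex.one_re]; linarith
  have e₃ : ((1 - z) + conj z').re < 1 := by simp only [Complex.add_re, Complex.conj_re, Complex.sub_re, Complex.one_re]; linarith
  have e₄ : ((1 - z) + conj (1 - z')).re < 1 := by simp only [Complex.add_re, Complex.conj_re, Complex.sub_re, Complex.one_re]; linarith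
  -- the four brackets from ★ file (1)
  have h₁ := ((hBr hβ hT0 hφm hφ'm hφN hφ'N hφB hφ'B hφC hφ'C (a := z) (a' := z') hΞ₁m hΞ₁K hΞ₁).1 e₁)
  have h₂ := ((hBr hβ hT0 hφm hφt'm hφN hφt'N hφB hφt'B hφC hφt'C (a := z) (a' := 1 - z') hΞ₂m hΞ₂K hΞ₂).1 e₂)
  have h₃ := ((hBr hβ hT0 hφtm hφ'm hφtN hφ'N hφtB hφ'B hφtC hφ'C (a := 1 - z) (a' := z') hΞ₃m hΞ₃K hΞ₃).2 e₃)
  have h₄ := ((hBr hβ hT0 hφtm hφt'm hφtN hφt'N hφtB hφt'B hφtC hφt'C (a := 1 - z) (a' := 1 - z') hΞ₄m hΞ₄K hΞ₄).2 e₄)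
  have q₂ : z + conj (1 - z') = (z - conj z') + 1 := by rw [map_sub, map_one]; ring
  have q₃ : (1 - z) + conj z' = -(z - conj z') + 1 := by ring
  have q₄ : (1 - z) + conj (1 - z') = -(z + conj z' - 1) + 1 := by rw [map_sub, map_one]; ring
  simp_rw [q₂] at h₂
  simp_rw [q₃] at h₃
  simp_rw [q₄] at h₄
  -- invariance∕measurability of the flat sections
  have hfm : Measurable (flatSectionU φ z) := measurable_flatSectionU hφm z
  have hMfm : Measurable (flatSectionU φt (1 - z)) := measurable_flatSectionU hφtm (1 - z)
  have hfB : ∀ b ∈ arithmeticBorel F E c 2, ∀ x : (quasiSplit F E c 2).Adelic, flatSectionU φ z ((b : (quasiSplit F E c 2).Adelic) * x) = flatSectionU φ z x := fun b hb x => by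
    rw [flatSectionU_apply, flatSectionU_apply, hφB b hb x, K2E1TruncatedEisensteinExplicit.borelHeight_arithmeticBorel_mul hb]
  have hMfB : ∀ b ∈ arithmeticBorel F E c 2, ∀ x : (quasiSplit F E c 2).Adelic, flatSectionU φt (1 - z) ((b : (quasiSplit F E c 2).Adelic) * x) = flatSectionU φt (1 - z) x := fun b hb x => by
    rw [flatSectionU_apply, flatSectionU_apply, hφtB b hb x, K2E1TruncatedEisensteinExplicit.borelHeight_arithmeticBorel_mul hb]
  have key := hMS hβ hT hfm hMfm hfB hMfB hCT hsum hΛm hΛG hΛbdd hψL1 hAVG hCT' hadj hM'ψ h₁.1 h₂.1 h₃.1 h₄.1 hi₅ hs₁ hs₂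
    hΞ₁m hΞ₁C hΞ₁K hΞ₁M hΞ₂m hΞ₂C hΞ₂K hΞ₂M hΞ₃m hΞ₃C hΞ₃K hΞ₃M hΞ₄m hΞ₄C hΞ₄K hΞ₄M
    (by simpa only [sub_add_cancel] using h₁.2) h₂.2 h₃.2 h₄.2
  exact key

end Generic

/-! ## §2 The CM pair `(L⁺, L, conj)`: every structural input of §1 is ★ — `hc`, `hc1`, Iwasawa, and the summability `hsum` -/

section CM

variable (L : Type) [Field L] [NumberField L] [IsCMField L]

/-- **`hsum` AT THE CM PAIR** (★ R2 CM p857569, `Re z > 1`, bounded coefficient): the Eisenstein series of the flat section `f_z = φ·H^z` of `U(J₂)` over `(L⁺, L, conj)` converges (absolutely)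
at every `g` — the `hsum` input of §1 `maassSelberg_flatSectionU_two` (and of §3), which at the CM pair is applied with `hc := AlgEquiv.ext fun x => IsCMField.complexConj_apply_apply L x`,
`hc1 := IsCMField.complexConj_ne_one L`, the `N`-generic CM Iwasawa decomposition for `hBK`, and `hsum := summable_flatSectionU_cm_two L hz hφ` (`1 < Re z` from the sub-tube
`1 < Re z′ < Re z`). [cite: Godement1964, §8] [cite: MoeglinWaldspurger1995, II.1.5] -/
theorem summable_flatSectionU_cm_two {z : ℂ} (hz : 1 < z.re)
    {φ : (quasiSplit (↥(maximalRealSubfield L)) L (IsCMField.complexConj L) 2).Adelic → ℂ} {C : ℝ} (hφ : ∀ x, ‖φ x‖ ≤ C)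
    (g : (quasiSplit (↥(maximalRealSubfield L)) L (IsCMField.complexConj L) 2).Adelic) :
    Summable fun q : Quotient (orbitRel ↥(borelU ((IsCMField.complexConj L : L ≃ₐ[↥(maximalRealSubfield L)] L) : L →+* L) ((StdForm.antidiagonal 2).over L))
        ↥(unitaryGroupOfForm ((IsCMField.complexConj L : L ≃ₐ[↥(maximalRealSubfield L)] L) : L →+* L) ((StdForm.antidiagonal 2).over L))) =>
      flatSectionU φ z ((quasiSplit (↥(maximalRealSubfield L)) L (IsCMField.complexConj L) 2).toAdelic
          (Quotient.out q : ↥(unitaryGroupOfForm ((IsCMField.complexConj L : L ≃ₐ[↥(maximalRealSubfield L)] L) : L →+* L) ((StdForm.antidiagonal 2).over L))) * g) :=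
  (summable_eisensteinSeriesU_flatSectionU_cm_two L hz hφ g).of_norm

end CM

/-! ## §3 `hAVG` and `hadj` DISCHARGED (★ p857644 `…_two`, ★ p857605 `…_two`): concrete intertwining operators -/

section Adjoint

open Summit.HodgeConjecture.HodgeConjecture.Cruxes.H413.K2E1TruncatedEisensteinExplicit (forall_arithmeticBorel_indicator)
open Summit.HodgeConjecture.HodgeConjecture.Cruxes.H413.K2E1BorelWeightAverage
open Summit.HodgeConjecture.HodgeConjecture.Cruxes.H413.K2E1IntertwiningAdjoint

variable {F E : Type} [Field F] [NumberField F] [Field E] [NumberField E] [Algebra F E] {c : E ≃ₐ[F] E} {N : ℕ} [NeZero N]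

/-- Height cut-offs see only the height (every `N`): `𝟙_{H ≤ T} F₁ (x) = 𝟙_{H ≤ T} F₁ (y)` and `𝟙_{T < H} F₁ (x) = 𝟙_{T < H} F₁ (y)` when `H x = H y` and `F₁ x = F₁ y`. [folklore] -/
theorem indicator_height_apply_eq {T : ℝ≥0} {F₁ : (quasiSplit F E c N).Adelic → ℂ} {x y : (quasiSplit F E c N).Adelic} (hH : borelHeight x = borelHeight y) (hF : F₁ x = F₁ y) :
    {y : (quasiSplit F E c N).Adelic | borelHeight y ≤ T}.indicator F₁ x = {y : (quasiSplit F E c N).Adelic | borelHeight y ≤ T}.indicator F₁ y ∧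
      {y : (quasiSplit F E c N).Adelic | T < borelHeight y}.indicator F₁ x = {y : (quasiSplit F E c N).Adelic | T < borelHeight y}.indicator F₁ y := by
  refine ⟨?_, ?_⟩
  · by_cases hy : borelHeight y ≤ T
    · rw [indicator_of_mem (show x ∈ {y : (quasiSplit F E c N).Adelic | borelHeight y ≤ T} by rw [Set.mem_setOf_eq, hH]; exact hy), indicator_of_mem (show y ∈ {y : (quasiSplit F E c N).Adelic | borelHeight y ≤ T} from hy), hF]
    · rw [indicator_of_notMem (show x ∉ {y : (quasiSplit F E c N).Adelic | borelHeight y ≤ T} by rw [Set.mem_setOf_eq, hH]; exact hy), indicator_of_notMem (show y ∉ {y : (quasiSplit F E c N).Adelic | borelHeight y ≤ T} from hy)]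
  · by_cases hy : T < borelHeight y
    · rw [indicator_of_mem (show x ∈ {y : (quasiSplit F E c N).Adelic | T < borelHeight y} by rw [Set.mem_setOf_eq, hH]; exact hy), indicator_of_mem (show y ∈ {y : (quasiSplit F E c N).Adelic | T < borelHeight y} from hy), hF]
    · rw [indicator_of_notMem (show x ∉ {y : (quasiSplit F E c N).Adelic | T < borelHeight y} by rw [Set.mem_setOf_eq, hH]; exact hy), indicator_of_notMem (show y ∉ {y : (quasiSplit F E c N).Adelic | T < borelHeight y} from hy)]

variable [MeasurableSpace (quasiSplit F E c 2).Adelic] [BorelSpace (quasiSplit F E c 2).Adelic]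
variable [MeasurableSpace (AdeleRing (𝓞 E) E)ˣ] [BorelSpace (AdeleRing (𝓞 E) E)ˣ]

/-- **THE MAASS–SELBERG RELATION FOR FLAT SECTIONS OF `U(J₂)` — CONCRETE INTERTWINING OPERATORS, `hadj` AND `hAVG` DISCHARGED.**  §1 with `ν` an inversion-invariant Haar measure on
`N(𝔸)`, `𝓕` a fundamental domain of `N(F)` of finite positive measure, `CT′ := borelConstantTerm ν 𝓕 Λ′` (averaging ★ p857644 `…_two`), `M h (g) := ∫_{N(𝔸)} h(w₀·u·g) dν`,
`M′ h (g) := ∫_{N(𝔸)} h(w₀⁻¹·u·g) dν` spelled out and the adjointness supplied by ★ p857605 `…_two` under its absolute-convergence inputs `habs`, `habs′`.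
[cite: MoeglinWaldspurger1995, II.1.8 and IV.2.1–IV.2.3] [cite: Arthur1980TraceFormulaII, §4] [cite: Garrett2018, §1.10 and §11.3] -/
theorem maassSelberg_flatSectionU_two_adj (hc : c * c = 1) (hc1 : c ≠ 1)
    (μ : Measure (quasiSplit F E c 2).automorphicQuotient) [(quasiSplit F E c 2).IsAutomorphicMeasure μ]
    (νG : Measure (quasiSplit F E c 2).Adelic) [νG.IsHaarMeasure] [νG.IsInvInvariant]
    (μK : Measure ((standardMaximalCompactGL 2 E).comap (adelicVal F E c 2 ((StdForm.antidiagonal 2).over E)) : Subgroup (quasiSplit F E c 2).Adelic))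
    [μK.IsHaarMeasure]
    (νI : Measure (AdeleRing (𝓞 E) E)ˣ) [νI.IsHaarMeasure]
    (hBK : ∀ g : (quasiSplit F E c 2).Adelic, ∃ b ∈ borelAdelic F E c 2, ∃ k : (quasiSplit F E c 2).Adelic,
      adelicVal F E c 2 ((StdForm.antidiagonal 2).over E) k ∈ standardMaximalCompactGL 2 E ∧ g = b * k)
    {𝓕I : Set (AdeleRing (𝓞 E) E)ˣ} (h𝓕I : IsIdeleClassDomain E 𝓕I)
    (ν : Measure ↥(adelicUnipotent F E c 2)) [ν.IsHaarMeasure] [ν.IsInvInvariant]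
    {𝓕 : Set ↥(adelicUnipotent F E c 2)} (h𝓕N : IsFundamentalDomain ↥(rationalUnipotent F E c 2) 𝓕 ν) (h𝓕₀ : ν 𝓕 ≠ 0) (h𝓕top : ν 𝓕 ≠ ∞) :
    ∃ cμ K : ℝ, 0 < cμ ∧ 0 < K ∧
      ∀ {β : (quasiSplit F E c 2).Adelic → ℝ≥0∞}, IsCoveringWeight ((arithmeticBorel F E c 2).map (quasiSplit F E c 2).arithmeticSubgroup.subtype) β →
      ∀ {T : ℝ≥0}, 1 ≤ T →
      ∀ {φ φ' φt φt' : (quasiSplit F E c 2).Adelic → ℂ},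
      Measurable φ →
        (∀ (n : unipotentInBorel F E c 2) (y : (quasiSplit F E c 2).Adelic), φ (((n : borelAdelic F E c 2) : (quasiSplit F E c 2).Adelic) * y) = φ y) →
        (∀ b ∈ arithmeticBorel F E c 2, ∀ y : (quasiSplit F E c 2).Adelic, φ ((b : (quasiSplit F E c 2).Adelic) * y) = φ y) →
      ∀ {Cφ : ℝ}, (∀ x, ‖φ x‖ ≤ Cφ) →
      Measurable φ' →
        (∀ (n : unipotentInBorel F E c 2) (y : (quasiSplit F E c 2).Adelic), φ' (((n : borelAdelic F E c 2) : (quasiSplit F E c 2).Adelic) * y) = φ' y) →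
        (∀ b ∈ arithmeticBorel F E c 2, ∀ y : (quasiSplit F E c 2).Adelic, φ' ((b : (quasiSplit F E c 2).Adelic) * y) = φ' y) →
      ∀ {Cφ' : ℝ}, (∀ x, ‖φ' x‖ ≤ Cφ') →
      Measurable φt →
        (∀ (n : unipotentInBorel F E c 2) (y : (quasiSplit F E c 2).Adelic), φt (((n : borelAdelic F E c 2) : (quasiSplit F E c 2).Adelic) * y) = φt y) →
        (∀ b ∈ arithmeticBorel F E c 2, ∀ y : (quasiSplit F E c 2).Adelic, φt ((b : (quasiSplit F E c 2).Adelic) * y) = φt y) →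
      ∀ {Cφt : ℝ}, (∀ x, ‖φt x‖ ≤ Cφt) →
      Measurable φt' →
        (∀ (n : unipotentInBorel F E c 2) (y : (quasiSplit F E c 2).Adelic), φt' (((n : borelAdelic F E c 2) : (quasiSplit F E c 2).Adelic) * y) = φt' y) →
        (∀ b ∈ arithmeticBorel F E c 2, ∀ y : (quasiSplit F E c 2).Adelic, φt' ((b : (quasiSplit F E c 2).Adelic) * y) = φt' y) →
      ∀ {Cφt' : ℝ}, (∀ x, ‖φt' x‖ ≤ Cφt') →
      ∀ {z z' : ℂ}, 1 < z'.re → z'.re < z.re →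
        (∀ x : (quasiSplit F E c 2).Adelic, T < borelHeight x → borelConstantTerm ν 𝓕 (eisensteinSeriesU (flatSectionU φ z)) x = flatSectionU φ z x + flatSectionU φt (1 - z) x) →
        (∀ g : (quasiSplit F E c 2).Adelic,
          Summable fun q : Quotient (orbitRel ↥(borelU (c : E →+* E) ((StdForm.antidiagonal 2).over E)) ↥(unitaryGroupOfForm (c : E →+* E) ((StdForm.antidiagonal 2).over E))) =>
            flatSectionU φ z ((quasiSplit F E c 2).toAdelic (q.out : ↥(unitaryGroupOfForm (c : E →+* E) ((StdForm.antidiagonal 2).over E))) * g)) →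
      ∀ {Λ' : (quasiSplit F E c 2).Adelic → ℂ},
        Measurable Λ' → (∀ (γ : (quasiSplit F E c 2).arithmeticSubgroup) (x : (quasiSplit F E c 2).Adelic), Λ' ((γ : (quasiSplit F E c 2).Adelic) * x) = Λ' x) →
        ∀ {M₁ : ℝ}, (∀ g, ‖Λ' g‖ ≤ M₁) →
        ∫⁻ g, β g * ‖({y : (quasiSplit F E c 2).Adelic | borelHeight y ≤ T}.indicator (flatSectionU φ z) g - {y : (quasiSplit F E c 2).Adelic | T < borelHeight y}.indicator (flatSectionU φt (1 - z)) g)‖ₑ ∂νG < ∞ →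
      -- two-piece constant term of `Λ′` and the `R6a` evaluation, against the CONCRETE operators
        (∀ g, borelConstantTerm ν 𝓕 Λ' g = {y : (quasiSplit F E c 2).Adelic | borelHeight y ≤ T}.indicator (flatSectionU φ' z' + flatSectionU φt' (1 - z')) g - (∫ u : ↥(adelicUnipotent F E c 2), {y : (quasiSplit F E c 2).Adelic | T < borelHeight y}.indicator (flatSectionU φ' z' + flatSectionU φt' (1 - z')) ((quasiSplit F E c 2).toAdelic (weylLongU (c : E →+* E) (rfl : (StdForm.antidiagonal 2).over E = (StdForm.antidiagonal 2).over E)) * ((u : (quasiSplit F E c 2).Adelic) * g)) ∂ν)) →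
        (∀ g, T < borelHeight g → (∫ u : ↥(adelicUnipotent F E c 2), ({y : (quasiSplit F E c 2).Adelic | borelHeight y ≤ T}.indicator (flatSectionU φ z) (((quasiSplit F E c 2).toAdelic (weylLongU (c : E →+* E) (rfl : (StdForm.antidiagonal 2).over E = (StdForm.antidiagonal 2).over E)))⁻¹ * ((u : (quasiSplit F E c 2).Adelic) * g)) - {y : (quasiSplit F E c 2).Adelic | T < borelHeight y}.indicator (flatSectionU φt (1 - z)) (((quasiSplit F E c 2).toAdelic (weylLongU (c : E →+* E) (rfl : (StdForm.antidiagonal 2).over E = (StdForm.antidiagonal 2).over E)))⁻¹ * ((u : (quasiSplit F E c 2).Adelic) * g))) ∂ν) = flatSectionU φt (1 - z) g) →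
        Integrable (fun g => (β g).toReal • (({y : (quasiSplit F E c 2).Adelic | borelHeight y ≤ T}.indicator (flatSectionU φ z) g - {y : (quasiSplit F E c 2).Adelic | T < borelHeight y}.indicator (flatSectionU φt (1 - z)) g) * conj (∫ u : ↥(adelicUnipotent F E c 2), {y : (quasiSplit F E c 2).Adelic | T < borelHeight y}.indicator (flatSectionU φ' z' + flatSectionU φt' (1 - z')) ((quasiSplit F E c 2).toAdelic (weylLongU (c : E →+* E) (rfl : (StdForm.antidiagonal 2).over E = (StdForm.antidiagonal 2).over E)) * ((u : (quasiSplit F E c 2).Adelic) * g)) ∂ν))) νG →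
      -- ★ p857605's absolute convergence (`h := χ`, `F := ψ`)
        ∫⁻ g, β g * ∫⁻ u : ↥(adelicUnipotent F E c 2), ‖{y : (quasiSplit F E c 2).Adelic | T < borelHeight y}.indicator (flatSectionU φ' z' + flatSectionU φt' (1 - z')) ((quasiSplit F E c 2).toAdelic (weylLongU (c : E →+* E) (rfl : (StdForm.antidiagonal 2).over E = (StdForm.antidiagonal 2).over E)) * ((u : (quasiSplit F E c 2).Adelic) * g)) * conj ({y : (quasiSplit F E c 2).Adelic | borelHeight y ≤ T}.indicator (flatSectionU φ z) g - {y : (quasiSplit F E c 2).Adelic | T < borelHeight y}.indicator (flatSectionU φt (1 - z)) g)‖ₑ ∂ν ∂νG < ∞ →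
        ∫⁻ g, β g * ∫⁻ u : ↥(adelicUnipotent F E c 2), ‖{y : (quasiSplit F E c 2).Adelic | T < borelHeight y}.indicator (flatSectionU φ' z' + flatSectionU φt' (1 - z')) g * conj ({y : (quasiSplit F E c 2).Adelic | borelHeight y ≤ T}.indicator (flatSectionU φ z) (((quasiSplit F E c 2).toAdelic (weylLongU (c : E →+* E) (rfl : (StdForm.antidiagonal 2).over E = (StdForm.antidiagonal 2).over E)))⁻¹ * ((u : (quasiSplit F E c 2).Adelic) * g)) - {y : (quasiSplit F E c 2).Adelic | T < borelHeight y}.indicator (flatSectionU φt (1 - z)) (((quasiSplit F E c 2).toAdelic (weylLongU (c : E →+* E) (rfl : (StdForm.antidiagonal 2).over E = (StdForm.antidiagonal 2).over E)))⁻¹ * ((u : (quasiSplit F E c 2).Adelic) * g)))‖ₑ ∂ν ∂νG < ∞ →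
      ∀ {Ξ₁ Ξ₂ Ξ₃ Ξ₄ : (AdeleRing (𝓞 E) E)ˣ → ℂ},
      Measurable Ξ₁ → ∀ {CΞ₁ : ℝ}, (∀ x, ‖Ξ₁ x‖ ≤ CΞ₁) → (∀ k ∈ GaloisRepresentations.principalIdeles E, ∀ x, Ξ₁ (k * x) = Ξ₁ x) →
        (∀ (r : ℝ≥0ˣ) (x : (AdeleRing (𝓞 E) E)ˣ), Ξ₁ (posRealIdele E r * x) = Ξ₁ x) →
        (∀ t : torusInBorel F E c 2,
          ∫ k, φ (((t : borelAdelic F E c 2) : (quasiSplit F E c 2).Adelic) * (k : (quasiSplit F E c 2).Adelic)) *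
              conj (φ' (((t : borelAdelic F E c 2) : (quasiSplit F E c 2).Adelic) * (k : (quasiSplit F E c 2).Adelic))) ∂μK = Ξ₁ (diagUnit (t : borelAdelic F E c 2).2 0)) →
      Measurable Ξ₂ → ∀ {CΞ₂ : ℝ}, (∀ x, ‖Ξ₂ x‖ ≤ CΞ₂) → (∀ k ∈ GaloisRepresentations.principalIdeles E, ∀ x, Ξ₂ (k * x) = Ξ₂ x) →
        (∀ (r : ℝ≥0ˣ) (x : (AdeleRing (𝓞 E) E)ˣ), Ξ₂ (posRealIdele E r * x) = Ξ₂ x) →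
        (∀ t : torusInBorel F E c 2,
          ∫ k, φ (((t : borelAdelic F E c 2) : (quasiSplit F E c 2).Adelic) * (k : (quasiSplit F E c 2).Adelic)) *
              conj (φt' (((t : borelAdelic F E c 2) : (quasiSplit F E c 2).Adelic) * (k : (quasiSplit F E c 2).Adelic))) ∂μK = Ξ₂ (diagUnit (t : borelAdelic F E c 2).2 0)) →
      Measurable Ξ₃ → ∀ {CΞ₃ : ℝ}, (∀ x, ‖Ξ₃ x‖ ≤ CΞ₃) → (∀ k ∈ GaloisRepresentations.principalIdeles E, ∀ x, Ξ₃ (k * x) = Ξ₃ x) →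
        (∀ (r : ℝ≥0ˣ) (x : (AdeleRing (𝓞 E) E)ˣ), Ξ₃ (posRealIdele E r * x) = Ξ₃ x) →
        (∀ t : torusInBorel F E c 2,
          ∫ k, φt (((t : borelAdelic F E c 2) : (quasiSplit F E c 2).Adelic) * (k : (quasiSplit F E c 2).Adelic)) *
              conj (φ' (((t : borelAdelic F E c 2) : (quasiSplit F E c 2).Adelic) * (k : (quasiSplit F E c 2).Adelic))) ∂μK = Ξ₃ (diagUnit (t : borelAdelic F E c 2).2 0)) →
      Measurable Ξ₄ → ∀ {CΞ₄ : ℝ}, (∀ x, ‖Ξ₄ x‖ ≤ CΞ₄) → (∀ k ∈ GaloisRepresentations.principalIdeles E, ∀ x, Ξ₄ (k * x) = Ξ₄ x) →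
        (∀ (r : ℝ≥0ˣ) (x : (AdeleRing (𝓞 E) E)ˣ), Ξ₄ (posRealIdele E r * x) = Ξ₄ x) →
        (∀ t : torusInBorel F E c 2,
          ∫ k, φt (((t : borelAdelic F E c 2) : (quasiSplit F E c 2).Adelic) * (k : (quasiSplit F E c 2).Adelic)) *
              conj (φt' (((t : borelAdelic F E c 2) : (quasiSplit F E c 2).Adelic) * (k : (quasiSplit F E c 2).Adelic))) ∂μK = Ξ₄ (diagUnit (t : borelAdelic F E c 2).2 0)) →
        ∫ x, (quasiSplit F E c 2).quotFun (truncation ν 𝓕 T (eisensteinSeriesU (flatSectionU φ z))) x * conj ((quasiSplit F E c 2).quotFun Λ' x) ∂μ =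
          (cμ : ℂ) * ((K : ℂ) *
            ((((T : ℝ) : ℂ) ^ (z + conj z' - 1) / (z + conj z' - 1)) * (∫ x in {x : (AdeleRing (𝓞 E) E)ˣ | (IdeleClassGroup.ideleNorm E x : ℝ) ≤ 1} ∩ 𝓕I, ((IdeleClassGroup.ideleNorm E x : ℝ) : ℂ) * Ξ₁ x ∂νI)
              + (((T : ℝ) : ℂ) ^ (z - conj z') / (z - conj z')) * (∫ x in {x : (AdeleRing (𝓞 E) E)ˣ | (IdeleClassGroup.ideleNorm E x : ℝ) ≤ 1} ∩ 𝓕I, ((IdeleClassGroup.ideleNorm E x : ℝ) : ℂ) * Ξ₂ x ∂νI)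
              - (((T : ℝ) : ℂ) ^ (-(z - conj z')) / (z - conj z')) * (∫ x in {x : (AdeleRing (𝓞 E) E)ˣ | (IdeleClassGroup.ideleNorm E x : ℝ) ≤ 1} ∩ 𝓕I, ((IdeleClassGroup.ideleNorm E x : ℝ) : ℂ) * Ξ₃ x ∂νI)
              - (((T : ℝ) : ℂ) ^ (-(z + conj z' - 1)) / (z + conj z' - 1)) * (∫ x in {x : (AdeleRing (𝓞 E) E)ˣ | (IdeleClassGroup.ideleNorm E x : ℝ) ≤ 1} ∩ 𝓕I, ((IdeleClassGroup.ideleNorm E x : ℝ) : ℂ) * Ξ₄ x ∂νI))) := by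
  obtain ⟨cμ, K, hcμ, hK, hGen⟩ := maassSelberg_flatSectionU_two hc hc1 μ νG μK νI hBK h𝓕I
  refine ⟨cμ, K, hcμ, hK, ?_⟩
  intro β hβ T hT φ φ' φt φt' hφm hφN hφB Cφ hφC hφ'm hφ'N hφ'B Cφ' hφ'C hφtm hφtN hφtB Cφt hφtC hφt'm hφt'N hφt'B Cφt' hφt'C
    z z' hz' hzz' hCT hsum Λ' hΛm hΛG M₁ hΛbdd hψL1 hCT' hM'ψ hi₅ habs habs'
    Ξ₁ Ξ₂ Ξ₃ Ξ₄ hΞ₁m CΞ₁ hΞ₁C hΞ₁K hΞ₁M hΞ₁ hΞ₂m CΞ₂ hΞ₂C hΞ₂K hΞ₂M hΞ₂ hΞ₃m CΞ₃ hΞ₃C hΞ₃K hΞ₃M hΞ₃ hΞ₄m CΞ₄ hΞ₄C hΞ₄K hΞ₄M hΞ₄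
  -- Borel-ness and invariances of `ψ` and `χ`
  have hSle : MeasurableSet {y : (quasiSplit F E c 2).Adelic | borelHeight y ≤ T} := (isClosed_setOf_borelHeight_le T).measurableSet
  have hSgt : MeasurableSet {y : (quasiSplit F E c 2).Adelic | T < borelHeight y} := measurableSet_lt measurable_const measurable_borelHeight
  have hψm : Measurable (fun x => ({y : (quasiSplit F E c 2).Adelic | borelHeight y ≤ T}.indicator (flatSectionU φ z) x - {y : (quasiSplit F E c 2).Adelic | T < borelHeight y}.indicator (flatSectionU φt (1 - z)) x)) :=
    ((measurable_flatSectionU hφm z).indicator hSle).sub ((measurable_flatSectionU hφtm (1 - z)).indicator hSgt)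
  have hχm : Measurable (fun x => {y : (quasiSplit F E c 2).Adelic | T < borelHeight y}.indicator (flatSectionU φ' z' + flatSectionU φt' (1 - z')) x) := ((measurable_flatSectionU hφ'm z').add (measurable_flatSectionU hφt'm (1 - z'))).indicator hSgt
  have hcoefN : ∀ {α : (quasiSplit F E c 2).Adelic → ℂ}, (∀ (n : unipotentInBorel F E c 2) (y : (quasiSplit F E c 2).Adelic), α (((n : borelAdelic F E c 2) : (quasiSplit F E c 2).Adelic) * y) = α y) →
      ∀ (a : ℂ) (u : ↥(adelicUnipotent F E c 2)) (g : (quasiSplit F E c 2).Adelic), flatSectionU α a ((u : (quasiSplit F E c 2).Adelic) * g) = flatSectionU α a g ∧ borelHeight ((u : (quasiSplit F E c 2).Adelic) * g) = borelHeight g := by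
    intro α hαN a u g
    have hn : u.1 ∈ adelicUnipotent F E c 2 := u.2
    have hH : borelHeight ((u : (quasiSplit F E c 2).Adelic) * g) = borelHeight g := borelHeight_unipotent_mul hn g
    refine ⟨?_, hH⟩
    rw [flatSectionU_apply, flatSectionU_apply, hαN ⟨⟨(u : (quasiSplit F E c 2).Adelic), adelicUnipotent_le_borelAdelic hn⟩, (mem_unipotentInBorel_iff _).2 hn⟩ g, hH]
  have hψN : ∀ (u : ↥(adelicUnipotent F E c 2)) (g : (quasiSplit F E c 2).Adelic), (fun x => ({y : (quasiSplit F E c 2).Adelic | borelHeight y ≤ T}.indicator (flatSectionU φ z) x - {y : (quasiSplit F E c 2).Adelic | T < borelHeight y}.indicator (flatSectionU φt (1 - z)) x)) ((u : (quasiSplit F E c 2).Adelic) * g) = (fun x => ({y : (quasiSplit F E c 2).Adelic | borelHeight y ≤ T}.indicator (flatSectionU φ z) x - {y : (quasiSplit F E c 2).Adelic | T < borelHeight y}.indicator (flatSectionU φt (1 - z)) x)) g := by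
    intro u g
    dsimp only
    rw [(indicator_height_apply_eq (hcoefN hφN z u g).2 (hcoefN hφN z u g).1).1, (indicator_height_apply_eq (hcoefN hφtN (1 - z) u g).2 (hcoefN hφtN (1 - z) u g).1).2]
  have hχN : ∀ (u : ↥(adelicUnipotent F E c 2)) (g : (quasiSplit F E c 2).Adelic), (fun x => {y : (quasiSplit F E c 2).Adelic | T < borelHeight y}.indicator (flatSectionU φ' z' + flatSectionU φt' (1 - z')) x) ((u : (quasiSplit F E c 2).Adelic) * g) = (fun x => {y : (quasiSplit F E c 2).Adelic | T < borelHeight y}.indicator (flatSectionU φ' z' + flatSectionU φt' (1 - z')) x) g := by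
    intro u g
    dsimp only
    have hsum' : (flatSectionU φ' z' + flatSectionU φt' (1 - z')) ((u : (quasiSplit F E c 2).Adelic) * g) = (flatSectionU φ' z' + flatSectionU φt' (1 - z')) g := by
      rw [Pi.add_apply, Pi.add_apply, (hcoefN hφ'N z' u g).1, (hcoefN hφt'N (1 - z') u g).1]
    exact (indicator_height_apply_eq (hcoefN hφ'N z' u g).2 hsum').2
  have hfB : ∀ {α : (quasiSplit F E c 2).Adelic → ℂ}, (∀ b ∈ arithmeticBorel F E c 2, ∀ y : (quasiSplit F E c 2).Adelic, α ((b : (quasiSplit F E c 2).Adelic) * y) = α y) →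
      ∀ (a : ℂ), ∀ b ∈ arithmeticBorel F E c 2, ∀ x : (quasiSplit F E c 2).Adelic, flatSectionU α a ((b : (quasiSplit F E c 2).Adelic) * x) = flatSectionU α a x := by
    intro α hαB a b hb x
    rw [flatSectionU_apply, flatSectionU_apply, hαB b hb x, K2E1TruncatedEisensteinExplicit.borelHeight_arithmeticBorel_mul hb]
  have hψB : ∀ b ∈ arithmeticBorel F E c 2, ∀ x : (quasiSplit F E c 2).Adelic, (fun x => ({y : (quasiSplit F E c 2).Adelic | borelHeight y ≤ T}.indicator (flatSectionU φ z) x - {y : (quasiSplit F E c 2).Adelic | T < borelHeight y}.indicator (flatSectionU φt (1 - z)) x)) ((b : (quasiSplit F E c 2).Adelic) * x) = (fun x => ({y : (quasiSplit F E c 2).Adelic | borelHeight y ≤ T}.indicator (flatSectionU φ z) x - {y : (quasiSplit F E c 2).Adelic | T < borelHeight y}.indicator (flatSectionU φt (1 - z)) x)) x := by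
    intro b hb x
    dsimp only
    rw [forall_arithmeticBorel_indicator (hfB hφB z) (fun h => h ≤ T) b hb x, forall_arithmeticBorel_indicator (hfB hφtB (1 - z)) (fun h => T < h) b hb x]
  have hsumB : ∀ b ∈ arithmeticBorel F E c 2, ∀ x : (quasiSplit F E c 2).Adelic, (flatSectionU φ' z' + flatSectionU φt' (1 - z')) ((b : (quasiSplit F E c 2).Adelic) * x) = (flatSectionU φ' z' + flatSectionU φt' (1 - z')) x := fun b hb x => by
    rw [Pi.add_apply, Pi.add_apply, hfB hφ'B z' b hb x, hfB hφt'B (1 - z') b hb x]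
  have hχB : ∀ b ∈ arithmeticBorel F E c 2, ∀ x : (quasiSplit F E c 2).Adelic, (fun x => {y : (quasiSplit F E c 2).Adelic | T < borelHeight y}.indicator (flatSectionU φ' z' + flatSectionU φt' (1 - z')) x) ((b : (quasiSplit F E c 2).Adelic) * x) = (fun x => {y : (quasiSplit F E c 2).Adelic | T < borelHeight y}.indicator (flatSectionU φ' z' + flatSectionU φt' (1 - z')) x) x := by
    intro b hb x
    dsimp only
    rw [forall_arithmeticBorel_indicator hsumB (fun h => T < h) b hb x]
  -- `hAVG` by ★ p857644 `…_two`
  have hΛB : ∀ b ∈ arithmeticBorel F E c 2, ∀ x : (quasiSplit F E c 2).Adelic, Λ' ((b : (quasiSplit F E c 2).Adelic) * x) = Λ' x := fun b _ x => hΛG b x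
  have hL1 : ∫⁻ g, β g * ‖({y : (quasiSplit F E c 2).Adelic | borelHeight y ≤ T}.indicator (flatSectionU φ z) g - {y : (quasiSplit F E c 2).Adelic | T < borelHeight y}.indicator (flatSectionU φt (1 - z)) g) * conj (Λ' g)‖ₑ ∂νG < ∞ := by
    have hM : ∀ g, ‖conj (Λ' g)‖ₑ ≤ ENNReal.ofReal M₁ := fun g => by
      rw [← ofReal_norm, Complex.norm_conj]; exact ENNReal.ofReal_le_ofReal (hΛbdd g)
    calc ∫⁻ g, β g * ‖({y : (quasiSplit F E c 2).Adelic | borelHeight y ≤ T}.indicator (flatSectionU φ z) g - {y : (quasiSplit F E c 2).Adelic | T < borelHeight y}.indicator (flatSectionU φt (1 - z)) g) * conj (Λ' g)‖ₑ ∂νG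
        ≤ ∫⁻ g, β g * ‖({y : (quasiSplit F E c 2).Adelic | borelHeight y ≤ T}.indicator (flatSectionU φ z) g - {y : (quasiSplit F E c 2).Adelic | T < borelHeight y}.indicator (flatSectionU φt (1 - z)) g)‖ₑ * ENNReal.ofReal M₁ ∂νG := lintegral_mono fun g => by rw [enorm_mul, ← mul_assoc]; gcongr; exact hM g
      _ = (∫⁻ g, β g * ‖({y : (quasiSplit F E c 2).Adelic | borelHeight y ≤ T}.indicator (flatSectionU φ z) g - {y : (quasiSplit F E c 2).Adelic | T < borelHeight y}.indicator (flatSectionU φt (1 - z)) g)‖ₑ ∂νG) * ENNReal.ofReal M₁ := lintegral_mul_const' _ _ ENNReal.ofReal_ne_top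
      _ < ∞ := ENNReal.mul_lt_top hψL1 ENNReal.ofReal_lt_top
  have hAVG := integral_wt_smul_mul_conj_eq_mul_conj_borelConstantTerm_two hc hc1 νG ν h𝓕N h𝓕₀ h𝓕top hβ hψm hΛm hψN hψB hΛB hL1
  -- the adjoint from ★ p857605 `…_two` by conjugation (`conj ((β g)·(A·conj B)) = (β g)·(B·conj A)`)
  have hP := integral_wt_smul_intertwining_mul_conj_eq_two hc hc1 νG ν hβ h𝓕N h𝓕₀ h𝓕top hχm hψm hχN hψN hχB hψB habs habs'
  have hadj : ∫ g, (β g).toReal • (({y : (quasiSplit F E c 2).Adelic | borelHeight y ≤ T}.indicator (flatSectionU φ z) g - {y : (quasiSplit F E c 2).Adelic | T < borelHeight y}.indicator (flatSectionU φt (1 - z)) g) * conj (∫ u : ↥(adelicUnipotent F E c 2), {y : (quasiSplit F E c 2).Adelic | T < borelHeight y}.indicator (flatSectionU φ' z' + flatSectionU φt' (1 - z')) ((quasiSplit F E c 2).toAdelic (weylLongU (c : E →+* E) (rfl : (StdForm.antidiagonal 2).over E = (StdForm.antidiagonal 2).over E)) * ((u : (quasiSplit F E c 2).Adelic) * g))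 ∂ν)) ∂νG = ∫ g, (β g).toReal • ((∫ u : ↥(adelicUnipotent F E c 2), ({y : (quasiSplit F E c 2).Adelic | borelHeight y ≤ T}.indicator (flatSectionU φ z) (((quasiSplit F E c 2).toAdelic (weylLongU (c : E →+* E) (rfl : (StdForm.antidiagonal 2).over E = (StdForm.antidiagonal 2).over E)))⁻¹ * ((u : (quasiSplit F E c 2).Adelic) * g)) - {y : (quasiSplit F E c 2).Adelic | T < borelHeight y}.indicator (flatSectionU φt (1 - z)) (((quasiSplit F E c 2).toAdelic (weylLongU (c : E →+* E) (rfl : (StdForm.antidiagonal 2).over E = (StdForm.antidiagonal 2).over E)))⁻¹ * ((u : (quasiSplit F E c 2).Adelic) * g))) ∂ν) * conj ({y : (quasiSplit F E c 2).Adelic | T < borelHeight y}.indicator (flatSectionU φ' z' + flatSectionU φt' (1 - z')) g)) ∂νG := by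
    have h1 := congrArg conj hP
    rw [← integral_conj, ← integral_conj] at h1
    have hcw : ∀ (r : ℝ) (A B : ℂ), conj (r • (A * conj B)) = r • (B * conj A) := fun r A B => by
      rw [Complex.real_smul, Complex.real_smul, map_mul, map_mul, Complex.conj_ofReal, Complex.conj_conj]; ring
    simp only [hcw] at h1
    exact h1
  exact hGen hβ hT hφm hφN hφB hφC hφ'm hφ'N hφ'B hφ'C hφtm hφtN hφtB hφtC hφt'm hφt'N hφt'B hφt'C hz' hzz' hCT hsum hΛm hΛG hΛbdd hψL1
    (CT' := borelConstantTerm ν 𝓕 Λ')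
    (M := fun hh g => ∫ u : ↥(adelicUnipotent F E c 2), hh ((quasiSplit F E c 2).toAdelic (weylLongU (c : E →+* E) (rfl : (StdForm.antidiagonal 2).over E = (StdForm.antidiagonal 2).over E)) * ((u : (quasiSplit F E c 2).Adelic) * g)) ∂ν)
    (M' := fun hh g => ∫ u : ↥(adelicUnipotent F E c 2), hh (((quasiSplit F E c 2).toAdelic (weylLongU (c : E →+* E) (rfl : (StdForm.antidiagonal 2).over E = (StdForm.antidiagonal 2).over E)))⁻¹ * ((u : (quasiSplit F E c 2).Adelic) * g)) ∂ν)
    hAVG hCT' hadj hM'ψ hi₅ hΞ₁m hΞ₁C hΞ₁K hΞ₁M hΞ₁ hΞ₂m hΞ₂C hΞ₂K hΞ₂M hΞ₂ hΞ₃m hΞ₃C hΞ₃K hΞ₃M hΞ₃ hΞ₄m hΞ₄C hΞ₄K hΞ₄M hΞ₄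

end Adjoint

end Summit.HodgeConjecture.HodgeConjecture.Cruxes.H413.K2E1MaassSelbergCMTwo

end
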